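import Literature.MathematicalPhysics.QuantumFieldTheory.ConformalBootstrap3D.MixedCertificateObligations
import Literature.MathematicalPhysics.QuantumFieldTheory.ConformalBootstrap3D.PointCertificateTwistGap

/-!
# Mixed `σ–ε` point certificates: the identity and the even-sector tail in closed form

Continuing `MixedCertificateObligations` (architecture B″ for the three-correlator system): for a
5-vector of point functionals `α⃗ = ofPoints z z̄ w` on common nodes in the open square
(fundamental domain `z̄_k ≤ z_k`, a dominating apex node `a`), the obligations that involve
infinitely many blocks in the EVEN sector are reduced to finitely many closed-form inequalities
between the certificate's own numbers, uniformly on a box `Q ⊆ [σ_lo, σ_hi] × [ε_lo, ε_hi]`: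

* two-weight evaluations `Σ_k (c_k v_k^s g(z_k) - d_k u_k^s g(1-z_k))` (`twoWeightEval`): the
  off-diagonal entry `Φ⁴₋ + Φ⁵₊` of the even term form is one, with `(c, d) = (w⁴+w⁵, w⁴-w⁵)`; their
  CORNER BOUNDS on a box `E ∈ [E₁,E₂]`, `s ∈ [s_lo,s_hi]` (`cornerBound₂`, `cornerBound₂_le`);
* rule (M) for the even sector: three corner numbers and one determinant inequality per box give the
  term form PSD on the box (`evenTermForm_nonneg_of_cornerBounds`);
* rule (T) for the even sector: the TWO-SIDED apex estimate
  `|Φ(E,j,t) - w_a v_a^t 𝒫_{E,j}(apex)| ≤ 𝒫_{E,j}(apex) · R(w,t,E)` (`apexRest`,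
  `abs_pointFunctional_crossF_zMono_sub_apex_le`, any `|sign| ≤ 1`) and the resulting PSD of every
  term form with `E ≥ E_T` from three apex numbers `X_T, Y_T ≥ 0`, `Z_T² ≤ 4 X_T Y_T`
  (`evenTermForm_nonneg_of_apex`);
* the even tail `Δ ≥ E₀` for all even spins, regular or not (`tail_evenPositive_of_boxes_and_apex`,
  twist-gap domain `j + τ ≤ E` for (M));
* the identity `(I)` from three corner numbers (`identityTerm_ofPoints_pos_of_cornerBounds`);
* the schema `boxExcluded_of_mixedPointRules`: (I), even light blocks (E2)–(E4) as `EvenPositive`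
  hypotheses (cell tables to come), even tail by (M)/(T), and the ODD sector (D2)–(D5) as
  hypotheses — its `σεσε` block has signed `z`-series coefficients near the leading twist line, so the
  odd tail needs a different device (pub-ising3d certs/MIXED-SCHEMA.md).

[cite: KosPolandSimmonsduffin2014, §3.3 eq. (3.16)]
-/

noncomputable section

namespace Literature.MathematicalPhysics.QuantumFieldTheory.ConformalBootstrap3D

open Finset Set Filter Topology

/-! ### Two-weight evaluations and corner bounds -/

/-- `Σ_k (c_k v_k^s g(z_k,z̄_k) - d_k u_k^s g(1-z_k,1-z̄_k))`, `v = (1-z)(1-z̄)`, `u = z z̄`: a point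
evaluation with independent direct and reflected weights. [folklore] -/
def twoWeightEval {N : ℕ} (c d z zb : Fin N → ℝ) (s : ℝ) (g : ℝ → ℝ → ℝ) : ℝ :=
  ∑ k, (c k * ((1 - z k) * (1 - zb k)) ^ s * g (z k) (zb k) -
    d k * (z k * zb k) ^ s * g (1 - z k) (1 - zb k))

/-- `φ_w[F^{s}_{-}[g]]` is the two-weight evaluation with `c = d = w`. [folklore] -/
theorem pointFunctional_crossF_neg_one_eq {N : ℕ} (w z zb : Fin N → ℝ) (s : ℝ) (g : ℝ → ℝ → ℝ) :
    pointFunctional w z zb (crossF s (-1) g) = twoWeightEval w w z zb s g := by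
  simp only [pointFunctional_apply, crossF, twoWeightEval]
  refine sum_congr rfl fun k _ => ?_
  ring

/-- `φ_{w₃}[F^{s}_{-}[g]] + φ_{w₄}[F^{s}_{+}[g]]` is the two-weight evaluation with
`(c, d) = (w₃ + w₄, w₃ - w₄)`. [folklore] -/
theorem sum45_eq_twoWeightEval {N : ℕ} (w₃ w₄ z zb : Fin N → ℝ) (s : ℝ) (g : ℝ → ℝ → ℝ) :
    pointFunctional w₃ z zb (crossF s (-1) g) + pointFunctional w₄ z zb (crossF s 1 g) =
      twoWeightEval (w₃ + w₄) (w₃ - w₄) z zb s g := by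
  simp only [pointFunctional_apply, crossF, twoWeightEval, ← sum_add_distrib, Pi.add_apply,
    Pi.sub_apply]
  refine sum_congr rfl fun k _ => ?_
  ring

/-- `φ_{w₃}[F^{t}_{-}[g]] - φ_{w₄}[F^{t}_{+}[g]]` is the two-weight evaluation with
`(c, d) = (w₃ - w₄, w₃ + w₄)`. [folklore] -/
theorem diff45_eq_twoWeightEval {N : ℕ} (w₃ w₄ z zb : Fin N → ℝ) (t : ℝ) (g : ℝ → ℝ → ℝ) :
    pointFunctional w₃ z zb (crossF t (-1) g) - pointFunctional w₄ z zb (crossF t 1 g) =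
      twoWeightEval (w₃ - w₄) (w₃ + w₄) z zb t g := by
  simp only [pointFunctional_apply, crossF, twoWeightEval, ← sum_sub_distrib, Pi.add_apply,
    Pi.sub_apply]
  refine sum_congr rfl fun k _ => ?_
  ring

/-- Negating both weight vectors negates the evaluation. [folklore] -/
theorem twoWeightEval_neg {N : ℕ} (c d z zb : Fin N → ℝ) (s : ℝ) (g : ℝ → ℝ → ℝ) :
    twoWeightEval (-c) (-d) z zb s g = -twoWeightEval c d z zb s g := by
  simp only [twoWeightEval, Pi.neg_apply, ← sum_neg_distrib]
  refine sum_congr rfl fun k _ => ?_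
  ring

/-- **Corner bound for a two-weight evaluation** of `𝒫_{E,j}` on the box `E ∈ [E₁, E₂]`,
`s ∈ [s_lo, s_hi]`: positive parts at the far corner, negative parts at the near corner
(`termCornerBound` is the case `c = d`). [folklore] -/
def cornerBound₂ {N : ℕ} (c d z zb : Fin N → ℝ) (j : ℕ) (E₁ E₂ slo shi : ℝ) : ℝ :=
  ∑ k, ((max (c k) 0 * (((1 - z k) * (1 - zb k)) ^ shi * zMono E₂ j (z k) (zb k))
        - max (-(c k)) 0 * (((1 - z k) * (1 - zb k)) ^ slo * zMono E₁ j (z k) (zb k)))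
      + (max (-(d k)) 0 * ((z k * zb k) ^ shi * zMono E₂ j (1 - z k) (1 - zb k))
        - max (d k) 0 * ((z k * zb k) ^ slo * zMono E₁ j (1 - z k) (1 - zb k))))

/-- **The corner bound is a lower bound on the whole box.** [folklore] -/
theorem cornerBound₂_le {N : ℕ} (c d z zb : Fin N → ℝ)
    (hz : ∀ k, z k ∈ Ioo (0 : ℝ) 1) (hzb : ∀ k, zb k ∈ Ioo (0 : ℝ) 1) (j : ℕ)
    {E₁ E₂ slo shi E s : ℝ} (hE : E ∈ Icc E₁ E₂) (hs : s ∈ Icc slo shi) :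
    cornerBound₂ c d z zb j E₁ E₂ slo shi ≤ twoWeightEval c d z zb s (zMono E j) := by
  unfold cornerBound₂ twoWeightEval
  refine sum_le_sum fun k _ => ?_
  have hz0 := (hz k).1; have hz1 := (hz k).2; have hzb0 := (hzb k).1; have hzb1 := (hzb k).2
  have hv : 0 < (1 - z k) * (1 - zb k) ∧ (1 - z k) * (1 - zb k) ≤ 1 :=
    ⟨mul_pos (by linarith) (by linarith), mul_le_one₀ (by linarith) (by linarith) (by linarith)⟩
  have hu : 0 < z k * zb k ∧ z k * zb k ≤ 1 := ⟨mul_pos hz0 hzb0, mul_le_one₀ hz1.le hzb0.le hzb1.le⟩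
  have hM1 : zMono E j (z k) (zb k) ≤ zMono E₁ j (z k) (zb k) :=
    zMono_le_zMono_of_le hz0 hz1 hzb0 hzb1 j hE.1
  have hM2 : zMono E₂ j (z k) (zb k) ≤ zMono E j (z k) (zb k) :=
    zMono_le_zMono_of_le hz0 hz1 hzb0 hzb1 j hE.2
  have hR1 : zMono E j (1 - z k) (1 - zb k) ≤ zMono E₁ j (1 - z k) (1 - zb k) :=
    zMono_le_zMono_of_le (by linarith) (by linarith) (by linarith) (by linarith) j hE.1
  have hR2 : zMono E₂ j (1 - z k) (1 - zb k) ≤ zMono E j (1 - z k) (1 - zb k) :=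
    zMono_le_zMono_of_le (by linarith) (by linarith) (by linarith) (by linarith) j hE.2
  have hv1 : ((1 - z k) * (1 - zb k)) ^ s ≤ ((1 - z k) * (1 - zb k)) ^ slo :=
    Real.rpow_le_rpow_of_exponent_ge hv.1 hv.2 hs.1
  have hv2 : ((1 - z k) * (1 - zb k)) ^ shi ≤ ((1 - z k) * (1 - zb k)) ^ s :=
    Real.rpow_le_rpow_of_exponent_ge hv.1 hv.2 hs.2
  have hu1 : (z k * zb k) ^ s ≤ (z k * zb k) ^ slo := Real.rpow_le_rpow_of_exponent_ge hu.1 hu.2 hs.1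
  have hu2 : (z k * zb k) ^ shi ≤ (z k * zb k) ^ s := Real.rpow_le_rpow_of_exponent_ge hu.1 hu.2 hs.2
  have hMn : ∀ E', 0 ≤ zMono E' j (z k) (zb k) := fun E' => zMono_nonneg E' j hz0.le hzb0.le
  have hRn : ∀ E', 0 ≤ zMono E' j (1 - z k) (1 - zb k) := fun E' =>
    zMono_nonneg E' j (by linarith) (by linarith)
  have h1 : ((1 - z k) * (1 - zb k)) ^ shi * zMono E₂ j (z k) (zb k) ≤
      ((1 - z k) * (1 - zb k)) ^ s * zMono E j (z k) (zb k) :=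
    mul_le_mul hv2 hM2 (hMn _) (Real.rpow_nonneg hv.1.le _)
  have h2 : ((1 - z k) * (1 - zb k)) ^ s * zMono E j (z k) (zb k) ≤
      ((1 - z k) * (1 - zb k)) ^ slo * zMono E₁ j (z k) (zb k) :=
    mul_le_mul hv1 hM1 (hMn _) (Real.rpow_nonneg hv.1.le _)
  have h3 : (z k * zb k) ^ shi * zMono E₂ j (1 - z k) (1 - zb k) ≤
      (z k * zb k) ^ s * zMono E j (1 - z k) (1 - zb k) :=
    mul_le_mul hu2 hR2 (hRn _) (Real.rpow_nonneg hu.1.le _)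
  have h4 : (z k * zb k) ^ s * zMono E j (1 - z k) (1 - zb k) ≤
      (z k * zb k) ^ slo * zMono E₁ j (1 - z k) (1 - zb k) :=
    mul_le_mul hu1 hR1 (hRn _) (Real.rpow_nonneg hu.1.le _)
  have i1 := max_mul_sub_max_mul_le (w := c k) h1 h2
  have i2 := max_neg_mul_sub_max_mul_le (w := d k) h3 h4
  calc (max (c k) 0 * (((1 - z k) * (1 - zb k)) ^ shi * zMono E₂ j (z k) (zb k))
        - max (-(c k)) 0 * (((1 - z k) * (1 - zb k)) ^ slo * zMono E₁ j (z k) (zb k)))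
      + (max (-(d k)) 0 * ((z k * zb k) ^ shi * zMono E₂ j (1 - z k) (1 - zb k))
        - max (d k) 0 * ((z k * zb k) ^ slo * zMono E₁ j (1 - z k) (1 - zb k)))
      ≤ c k * (((1 - z k) * (1 - zb k)) ^ s * zMono E j (z k) (zb k))
        + -(d k * ((z k * zb k) ^ s * zMono E j (1 - z k) (1 - zb k))) := add_le_add i1 i2
    _ = c k * ((1 - z k) * (1 - zb k)) ^ s * zMono E j (z k) (zb k)
        - d k * (z k * zb k) ^ s * zMono E j (1 - z k) (1 - zb k) := by ring

/-! ### Rule (M) for the even sector: one box, four numbers -/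

/-- **(M), even sector.** On the box `E ∈ [E₁, E₂]`, `Δ_σ ∈ [σ_lo, σ_hi]`, `Δ_ε ∈ [ε_lo, ε_hi]`
(so `s ∈ [(σ_lo+ε_lo)/2, (σ_hi+ε_hi)/2]`): with the corner numbers `x = termCornerBound(w¹; σ)`,
`y = termCornerBound(w²; ε)`, `z₋ = cornerBound₂(w⁴+w⁵, w⁴-w⁵; s)` (`≤ Φ⁴₋+Φ⁵₊`) and
`z₊ = cornerBound₂(-(w⁴+w⁵), -(w⁴-w⁵); s)` (`≤ -(Φ⁴₋+Φ⁵₊)`), the checks `x ≥ 0`, `y ≥ 0`,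
`max(|z₋|,|z₊|)² ≤ 4xy` give the term form PSD on the whole box. [folklore] -/
theorem evenTermForm_nonneg_of_cornerBounds {N : ℕ} (z zb : Fin N → ℝ) (w : Fin 5 → Fin N → ℝ)
    (hz : ∀ k, z k ∈ Ioo (0 : ℝ) 1) (hzb : ∀ k, zb k ∈ Ioo (0 : ℝ) 1) (j : ℕ)
    {E₁ E₂ σlo σhi εlo εhi : ℝ}
    (hX : 0 ≤ termCornerBound (w 0) z zb j E₁ E₂ σlo σhi)
    (hY : 0 ≤ termCornerBound (w 1) z zb j E₁ E₂ εlo εhi)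
    (hZ : max |cornerBound₂ (w 3 + w 4) (w 3 - w 4) z zb j E₁ E₂ ((σlo + εlo) / 2) ((σhi + εhi) / 2)|
          |cornerBound₂ (-(w 3 + w 4)) (-(w 3 - w 4)) z zb j E₁ E₂ ((σlo + εlo) / 2)
            ((σhi + εhi) / 2)| ^ 2 ≤
        4 * termCornerBound (w 0) z zb j E₁ E₂ σlo σhi * termCornerBound (w 1) z zb j E₁ E₂ εlo εhi) :
    ∀ E ∈ Icc E₁ E₂, ∀ Δσ ∈ Icc σlo σhi, ∀ Δε ∈ Icc εlo εhi, ∀ x y : ℝ,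
      0 ≤ evenTermForm z zb w Δσ Δε E j x y := by
  intro E hE Δσ hσ Δε hε x y
  set xlo := termCornerBound (w 0) z zb j E₁ E₂ σlo σhi
  set ylo := termCornerBound (w 1) z zb j E₁ E₂ εlo εhi
  set zm := cornerBound₂ (w 3 + w 4) (w 3 - w 4) z zb j E₁ E₂ ((σlo + εlo) / 2) ((σhi + εhi) / 2)
  set zp := cornerBound₂ (-(w 3 + w 4)) (-(w 3 - w 4)) z zb j E₁ E₂ ((σlo + εlo) / 2)
    ((σhi + εhi) / 2)
  have hs : (Δσ + Δε) / 2 ∈ Icc ((σlo + εlo) / 2) ((σhi + εhi) / 2) :=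
    ⟨by linarith [hσ.1, hε.1], by linarith [hσ.2, hε.2]⟩
  have hXle : xlo ≤ pointFunctional (w 0) z zb (crossF Δσ (-1) (zMono E j)) :=
    termCornerBound_le (w 0) z zb hz hzb j hE hσ
  have hYle : ylo ≤ pointFunctional (w 1) z zb (crossF Δε (-1) (zMono E j)) :=
    termCornerBound_le (w 1) z zb hz hzb j hE hε
  set Z := pointFunctional (w 3) z zb (crossF ((Δσ + Δε) / 2) (-1) (zMono E j)) +
    pointFunctional (w 4) z zb (crossF ((Δσ + Δε) / 2) 1 (zMono E j))
  have hZeq : Z = twoWeightEval (w 3 + w 4) (w 3 - w 4) z zb ((Δσ + Δε) / 2) (zMono E j) :=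
    sum45_eq_twoWeightEval _ _ z zb _ _
  have hZlo : zm ≤ Z := by rw [hZeq]; exact cornerBound₂_le _ _ z zb hz hzb j hE hs
  have hZhi : Z ≤ -zp := by
    have h := cornerBound₂_le (-(w 3 + w 4)) (-(w 3 - w 4)) z zb hz hzb j hE hs
    rw [twoWeightEval_neg, ← hZeq] at h
    linarith
  set m := max |zm| |zp|
  have hm1 : -m ≤ Z := by
    have : -|zm| ≤ zm := neg_abs_le _
    linarith [le_max_left |zm| |zp|]
  have hm2 : Z ≤ m := by
    have : -zp ≤ |zp| := by rw [← abs_neg]; exact le_abs_self _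
    linarith [le_max_right |zm| |zp|]
  have hZsq : Z ^ 2 ≤ m ^ 2 := sq_le_sq' hm1 hm2
  refine evenTermForm_nonneg_of_det z zb w (hX.trans hXle) (hY.trans hYle) ?_ x y
  calc Z ^ 2 ≤ m ^ 2 := hZsq
    _ ≤ 4 * xlo * ylo := hZ
    _ ≤ 4 * pointFunctional (w 0) z zb (crossF Δσ (-1) (zMono E j)) *
          pointFunctional (w 1) z zb (crossF Δε (-1) (zMono E j)) :=
        mul_le_mul (mul_le_mul_of_nonneg_left hXle (by norm_num)) hYle hY
          (mul_nonneg (by norm_num) (hX.trans hXle))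

/-! ### Rule (T) for the even sector: the two-sided apex estimate -/

/-- The apex remainder `R(w; t, T) = Σ_{k≠a} |w_k| v_k^t qd_k^T + Σ_k |w_k| u_k^t qr_k^T`. [folklore] -/
def apexRest {N : ℕ} (w z zb : Fin N → ℝ) (a : Fin N) (qd qr : Fin N → ℝ) (t T : ℝ) : ℝ :=
  ∑ k ∈ univ.erase a, |w k| * ((1 - z k) * (1 - zb k)) ^ t * qd k ^ T
    + ∑ k, |w k| * (z k * zb k) ^ t * qr k ^ T

/-- `R ≥ 0`. [folklore] -/
theorem apexRest_nonneg {N : ℕ} (w z zb : Fin N → ℝ) (hz : ∀ k, z k ∈ Ioo (0 : ℝ) 1)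
    (hzb : ∀ k, zb k ∈ Ioo (0 : ℝ) 1) (a : Fin N) (qd qr : Fin N → ℝ) (hqd : ∀ k, 0 ≤ qd k)
    (hqr : ∀ k, 0 ≤ qr k) (t T : ℝ) : 0 ≤ apexRest w z zb a qd qr t T := by
  unfold apexRest
  refine add_nonneg (sum_nonneg fun k _ => ?_) (sum_nonneg fun k _ => ?_)
  · exact mul_nonneg (mul_nonneg (abs_nonneg _) (Real.rpow_nonneg
      (mul_nonneg (by linarith [(hz k).2]) (by linarith [(hzb k).2])) _)) (Real.rpow_nonneg (hqd k) _)
  · exact mul_nonneg (mul_nonneg (abs_nonneg _) (Real.rpow_nonneg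
      (mul_nonneg (hz k).1.le (hzb k).1.le) _)) (Real.rpow_nonneg (hqr k) _)

/-- `R` is non-increasing in the exponent `t` (`u_k, v_k ∈ (0, 1]`). [folklore] -/
theorem apexRest_anti_exponent {N : ℕ} (w z zb : Fin N → ℝ) (hz : ∀ k, z k ∈ Ioo (0 : ℝ) 1)
    (hzb : ∀ k, zb k ∈ Ioo (0 : ℝ) 1) (a : Fin N) (qd qr : Fin N → ℝ) (hqd : ∀ k, 0 ≤ qd k)
    (hqr : ∀ k, 0 ≤ qr k) {t t' : ℝ} (h : t ≤ t') (T : ℝ) :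
    apexRest w z zb a qd qr t' T ≤ apexRest w z zb a qd qr t T := by
  have hv : ∀ k, 0 < (1 - z k) * (1 - zb k) ∧ (1 - z k) * (1 - zb k) ≤ 1 := fun k =>
    ⟨mul_pos (by linarith [(hz k).2]) (by linarith [(hzb k).2]),
      mul_le_one₀ (by linarith [(hz k).1]) (by linarith [(hzb k).2]) (by linarith [(hzb k).1])⟩
  have hu : ∀ k, 0 < z k * zb k ∧ z k * zb k ≤ 1 := fun k =>
    ⟨mul_pos (hz k).1 (hzb k).1, mul_le_one₀ (hz k).2.le (hzb k).1.le (hzb k).2.le⟩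
  unfold apexRest
  refine add_le_add (sum_le_sum fun k _ => ?_) (sum_le_sum fun k _ => ?_)
  · exact mul_le_mul_of_nonneg_right (mul_le_mul_of_nonneg_left
      (Real.rpow_le_rpow_of_exponent_ge (hv k).1 (hv k).2 h) (abs_nonneg _))
      (Real.rpow_nonneg (hqd k) _)
  · exact mul_le_mul_of_nonneg_right (mul_le_mul_of_nonneg_left
      (Real.rpow_le_rpow_of_exponent_ge (hu k).1 (hu k).2 h) (abs_nonneg _))
      (Real.rpow_nonneg (hqr k) _)

/-- `R` is non-increasing in the level `T` (ratios `qd_k, qr_k ∈ (0, 1]`). [folklore] -/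
theorem apexRest_anti_level {N : ℕ} (w z zb : Fin N → ℝ) (hz : ∀ k, z k ∈ Ioo (0 : ℝ) 1)
    (hzb : ∀ k, zb k ∈ Ioo (0 : ℝ) 1) (a : Fin N) (qd qr : Fin N → ℝ)
    (hqd : ∀ k, 0 < qd k ∧ qd k ≤ 1) (hqr : ∀ k, 0 < qr k ∧ qr k ≤ 1) (t : ℝ) {T T' : ℝ}
    (h : T ≤ T') : apexRest w z zb a qd qr t T' ≤ apexRest w z zb a qd qr t T := by
  have hv0 : ∀ k, 0 ≤ (1 - z k) * (1 - zb k) := fun k =>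
    mul_nonneg (by linarith [(hz k).2]) (by linarith [(hzb k).2])
  have hu0 : ∀ k, 0 ≤ z k * zb k := fun k => mul_nonneg (hz k).1.le (hzb k).1.le
  unfold apexRest
  refine add_le_add (sum_le_sum fun k _ => ?_) (sum_le_sum fun k _ => ?_)
  · exact mul_le_mul_of_nonneg_left (Real.rpow_le_rpow_of_exponent_ge (hqd k).1 (hqd k).2 h)
      (mul_nonneg (abs_nonneg _) (Real.rpow_nonneg (hv0 k) _))
  · exact mul_le_mul_of_nonneg_left (Real.rpow_le_rpow_of_exponent_ge (hqr k).1 (hqr k).2 h)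
      (mul_nonneg (abs_nonneg _) (Real.rpow_nonneg (hu0 k) _))

/-- **Two-sided apex estimate.** In the dominated configuration (apex `a`; `z_k z̄_k ≤ qd_k² z_a z̄_a`,
`z_k ≤ qd_k z_a`; `(1-z_k)(1-z̄_k) ≤ qr_k² z_a z̄_a`, `1-z̄_k ≤ qr_k z_a`), for `j ≤ E` and any
`|sign| ≤ 1`: `|φ_w[F^{t}_{sign}[𝒫_{E,j}]] - w_a v_a^t 𝒫_{E,j}(z_a,z̄_a)| ≤ 𝒫_{E,j}(z_a,z̄_a) · R(w; t, E)`.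
[folklore] -/
theorem abs_pointFunctional_crossF_zMono_sub_apex_le {N : ℕ} (w z zb : Fin N → ℝ)
    (hz : ∀ k, z k ∈ Ioo (0 : ℝ) 1) (hzb : ∀ k, zb k ∈ Ioo (0 : ℝ) 1) (hord : ∀ k, zb k ≤ z k)
    (a : Fin N) (qd qr : Fin N → ℝ) (hqd : ∀ k, 0 < qd k) (hqr : ∀ k, 0 < qr k)
    (hdomd : ∀ k, z k * zb k ≤ qd k ^ 2 * (z a * zb a) ∧ z k ≤ qd k * z a)
    (hdomr : ∀ k, (1 - z k) * (1 - zb k) ≤ qr k ^ 2 * (z a * zb a) ∧ 1 - zb k ≤ qr k * z a)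
    {E : ℝ} {j : ℕ} (hjE : (j : ℝ) ≤ E) (t sign : ℝ) (hsign : |sign| ≤ 1) :
    |pointFunctional w z zb (crossF t sign (zMono E j)) -
        w a * ((1 - z a) * (1 - zb a)) ^ t * zMono E j (z a) (zb a)| ≤
      zMono E j (z a) (zb a) * apexRest w z zb a qd qr t E := by
  have hv0 : ∀ k, 0 ≤ (1 - z k) * (1 - zb k) := fun k =>
    mul_nonneg (by linarith [(hz k).2]) (by linarith [(hzb k).2])
  have hu0 : ∀ k, 0 ≤ z k * zb k := fun k => mul_nonneg (hz k).1.le (hzb k).1.le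
  have hM0 : ∀ k, 0 ≤ zMono E j (z k) (zb k) := fun k => zMono_nonneg E j (hz k).1.le (hzb k).1.le
  have hR0 : ∀ k, 0 ≤ zMono E j (1 - z k) (1 - zb k) := fun k =>
    zMono_nonneg E j (by linarith [(hz k).2]) (by linarith [(hzb k).2])
  have hMk : ∀ k, zMono E j (z k) (zb k) ≤ qd k ^ E * zMono E j (z a) (zb a) := fun k =>
    zMono_le_of_dominated (hzb k).1 (hord k) (hzb a).1 (hord a) (hqd k) (hdomd k).1 (hdomd k).2 hjE
  have hRk : ∀ k, zMono E j (1 - z k) (1 - zb k) ≤ qr k ^ E * zMono E j (z a) (zb a) := by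
    intro k
    rw [← zMono_symm]
    have h1 : (1 - zb k) * (1 - z k) ≤ qr k ^ 2 * (z a * zb a) := by
      rw [mul_comm]; exact (hdomr k).1
    exact zMono_le_of_dominated (by linarith [(hz k).2]) (by linarith [hord k]) (hzb a).1 (hord a)
      (hqr k) h1 (hdomr k).2 hjE
  set P := zMono E j (z a) (zb a) with hP
  -- the decomposition Φ - (apex direct term) = Σ_{k≠a} direct + Σ_k reflected
  have hdec : pointFunctional w z zb (crossF t sign (zMono E j)) -
      w a * ((1 - z a) * (1 - zb a)) ^ t * zMono E j (z a) (zb a) =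
      ∑ k ∈ univ.erase a, w k * ((1 - z k) * (1 - zb k)) ^ t * zMono E j (z k) (zb k) +
        ∑ k, sign * w k * (z k * zb k) ^ t * zMono E j (1 - z k) (1 - zb k) := by
    rw [pointFunctional_apply]
    have hsplit : ∑ k, w k * crossF t sign (zMono E j) (z k) (zb k) =
        ∑ k, w k * ((1 - z k) * (1 - zb k)) ^ t * zMono E j (z k) (zb k) +
          ∑ k, sign * w k * (z k * zb k) ^ t * zMono E j (1 - z k) (1 - zb k) := by
      rw [← sum_add_distrib]
      refine sum_congr rfl fun k _ => ?_
      simp only [crossF]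
      ring
    rw [hsplit, ← add_sum_erase univ (fun k => w k * ((1 - z k) * (1 - zb k)) ^ t *
      zMono E j (z k) (zb k)) (mem_univ a)]
    ring
  rw [hdec]
  have hb1 : ∀ k, |w k * ((1 - z k) * (1 - zb k)) ^ t * zMono E j (z k) (zb k)| ≤
      |w k| * ((1 - z k) * (1 - zb k)) ^ t * qd k ^ E * P := by
    intro k
    rw [abs_mul, abs_mul, abs_of_nonneg (Real.rpow_nonneg (hv0 k) t), abs_of_nonneg (hM0 k)]
    have := mul_le_mul_of_nonneg_left (hMk k)
      (mul_nonneg (abs_nonneg (w k)) (Real.rpow_nonneg (hv0 k) t))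
    calc |w k| * ((1 - z k) * (1 - zb k)) ^ t * zMono E j (z k) (zb k)
        ≤ |w k| * ((1 - z k) * (1 - zb k)) ^ t * (qd k ^ E * zMono E j (z a) (zb a)) := this
      _ = |w k| * ((1 - z k) * (1 - zb k)) ^ t * qd k ^ E * P := by rw [hP]; ring
  have hb2 : ∀ k, |sign * w k * (z k * zb k) ^ t * zMono E j (1 - z k) (1 - zb k)| ≤
      |w k| * (z k * zb k) ^ t * qr k ^ E * P := by
    intro k
    rw [abs_mul, abs_mul, abs_mul, abs_of_nonneg (Real.rpow_nonneg (hu0 k) t),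
      abs_of_nonneg (hR0 k)]
    have h1 : |sign| * |w k| * (z k * zb k) ^ t * zMono E j (1 - z k) (1 - zb k) ≤
        1 * |w k| * (z k * zb k) ^ t * zMono E j (1 - z k) (1 - zb k) :=
      mul_le_mul_of_nonneg_right (mul_le_mul_of_nonneg_right
        (mul_le_mul_of_nonneg_right hsign (abs_nonneg _)) (Real.rpow_nonneg (hu0 k) t)) (hR0 k)
    have h2 := mul_le_mul_of_nonneg_left (hRk k)
      (mul_nonneg (abs_nonneg (w k)) (Real.rpow_nonneg (hu0 k) t))
    calc |sign| * |w k| * (z k * zb k) ^ t * zMono E j (1 - z k) (1 - zb k)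
        ≤ 1 * |w k| * (z k * zb k) ^ t * zMono E j (1 - z k) (1 - zb k) := h1
      _ = |w k| * (z k * zb k) ^ t * zMono E j (1 - z k) (1 - zb k) := by ring
      _ ≤ |w k| * (z k * zb k) ^ t * (qr k ^ E * zMono E j (z a) (zb a)) := h2
      _ = |w k| * (z k * zb k) ^ t * qr k ^ E * P := by rw [hP]; ring
  calc |∑ k ∈ univ.erase a, w k * ((1 - z k) * (1 - zb k)) ^ t * zMono E j (z k) (zb k) +
          ∑ k, sign * w k * (z k * zb k) ^ t * zMono E j (1 - z k) (1 - zb k)|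
      ≤ |∑ k ∈ univ.erase a, w k * ((1 - z k) * (1 - zb k)) ^ t * zMono E j (z k) (zb k)| +
          |∑ k, sign * w k * (z k * zb k) ^ t * zMono E j (1 - z k) (1 - zb k)| := abs_add_le _ _
    _ ≤ ∑ k ∈ univ.erase a, |w k * ((1 - z k) * (1 - zb k)) ^ t * zMono E j (z k) (zb k)| +
          ∑ k, |sign * w k * (z k * zb k) ^ t * zMono E j (1 - z k) (1 - zb k)| :=
        add_le_add (abs_sum_le_sum_abs _ _) (abs_sum_le_sum_abs _ _)
    _ ≤ ∑ k ∈ univ.erase a, |w k| * ((1 - z k) * (1 - zb k)) ^ t * qd k ^ E * P +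
          ∑ k, |w k| * (z k * zb k) ^ t * qr k ^ E * P :=
        add_le_add (sum_le_sum fun k _ => hb1 k) (sum_le_sum fun k _ => hb2 k)
    _ = P * apexRest w z zb a qd qr t E := by
        rw [apexRest, mul_add, mul_sum, mul_sum]
        congr 1 <;> exact sum_congr rfl fun k _ => by ring

/-- One-sided forms of the apex estimate. [folklore] -/
theorem apex_bounds_pointFunctional_crossF_zMono {N : ℕ} (w z zb : Fin N → ℝ)
    (hz : ∀ k, z k ∈ Ioo (0 : ℝ) 1) (hzb : ∀ k, zb k ∈ Ioo (0 : ℝ) 1) (hord : ∀ k, zb k ≤ z k)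
    (a : Fin N) (qd qr : Fin N → ℝ) (hqd : ∀ k, 0 < qd k) (hqr : ∀ k, 0 < qr k)
    (hdomd : ∀ k, z k * zb k ≤ qd k ^ 2 * (z a * zb a) ∧ z k ≤ qd k * z a)
    (hdomr : ∀ k, (1 - z k) * (1 - zb k) ≤ qr k ^ 2 * (z a * zb a) ∧ 1 - zb k ≤ qr k * z a)
    {E : ℝ} {j : ℕ} (hjE : (j : ℝ) ≤ E) (t sign : ℝ) (hsign : |sign| ≤ 1) :
    zMono E j (z a) (zb a) * (w a * ((1 - z a) * (1 - zb a)) ^ t - apexRest w z zb a qd qr t E) ≤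
        pointFunctional w z zb (crossF t sign (zMono E j)) ∧
      pointFunctional w z zb (crossF t sign (zMono E j)) ≤
        zMono E j (z a) (zb a) * (w a * ((1 - z a) * (1 - zb a)) ^ t + apexRest w z zb a qd qr t E) := by
  have h := abs_pointFunctional_crossF_zMono_sub_apex_le w z zb hz hzb hord a qd qr hqd hqr hdomd hdomr
    hjE t sign hsign
  rw [abs_le] at h
  constructor
  · nlinarith [h.1]
  · nlinarith [h.2]

/-- **(T), even sector.** With `v_a = (1-z_a)(1-z̄_a)`, `s_lo = (σ_lo+ε_lo)/2` and the apex numbers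
`X_T = w¹_a v_a^{σ_hi} - R(w¹; σ_lo, E_T)`, `Y_T = w²_a v_a^{ε_hi} - R(w²; ε_lo, E_T)`,
`Z_T = |w⁴_a + w⁵_a| v_a^{s_lo} + R(w⁴; s_lo, E_T) + R(w⁵; s_lo, E_T)` (`w¹_a, w²_a ≥ 0`), the checks
`X_T ≥ 0`, `Y_T ≥ 0`, `Z_T² ≤ 4 X_T Y_T` give the even term form PSD for every real `E ≥ E_T`, every
`j ≤ E` and every `(Δ_σ, Δ_ε)` in the box. [folklore] -/
theorem evenTermForm_nonneg_of_apex {N : ℕ} (z zb : Fin N → ℝ) (w : Fin 5 → Fin N → ℝ)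
    (hz : ∀ k, z k ∈ Ioo (0 : ℝ) 1) (hzb : ∀ k, zb k ∈ Ioo (0 : ℝ) 1) (hord : ∀ k, zb k ≤ z k)
    (a : Fin N) (qd qr : Fin N → ℝ) (hqd : ∀ k, 0 < qd k ∧ qd k ≤ 1)
    (hqr : ∀ k, 0 < qr k ∧ qr k ≤ 1)
    (hdomd : ∀ k, z k * zb k ≤ qd k ^ 2 * (z a * zb a) ∧ z k ≤ qd k * z a)
    (hdomr : ∀ k, (1 - z k) * (1 - zb k) ≤ qr k ^ 2 * (z a * zb a) ∧ 1 - zb k ≤ qr k * z a)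
    {σlo σhi εlo εhi ET : ℝ} (h0 : 0 ≤ w 0 a) (h1 : 0 ≤ w 1 a)
    (hX : 0 ≤ w 0 a * ((1 - z a) * (1 - zb a)) ^ σhi - apexRest (w 0) z zb a qd qr σlo ET)
    (hY : 0 ≤ w 1 a * ((1 - z a) * (1 - zb a)) ^ εhi - apexRest (w 1) z zb a qd qr εlo ET)
    (hZ : (|w 3 a + w 4 a| * ((1 - z a) * (1 - zb a)) ^ ((σlo + εlo) / 2)
            + apexRest (w 3) z zb a qd qr ((σlo + εlo) / 2) ET
            + apexRest (w 4) z zb a qd qr ((σlo + εlo) / 2) ET) ^ 2 ≤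
        4 * (w 0 a * ((1 - z a) * (1 - zb a)) ^ σhi - apexRest (w 0) z zb a qd qr σlo ET) *
          (w 1 a * ((1 - z a) * (1 - zb a)) ^ εhi - apexRest (w 1) z zb a qd qr εlo ET)) :
    ∀ E : ℝ, ET ≤ E → ∀ j : ℕ, (j : ℝ) ≤ E → ∀ Δσ ∈ Icc σlo σhi, ∀ Δε ∈ Icc εlo εhi,
      ∀ x y : ℝ, 0 ≤ evenTermForm z zb w Δσ Δε E j x y := by
  intro E hTE j hjE Δσ hσ Δε hε x y
  set XT := w 0 a * ((1 - z a) * (1 - zb a)) ^ σhi - apexRest (w 0) z zb a qd qr σlo ET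
  set YT := w 1 a * ((1 - z a) * (1 - zb a)) ^ εhi - apexRest (w 1) z zb a qd qr εlo ET
  set ZT := |w 3 a + w 4 a| * ((1 - z a) * (1 - zb a)) ^ ((σlo + εlo) / 2)
    + apexRest (w 3) z zb a qd qr ((σlo + εlo) / 2) ET
    + apexRest (w 4) z zb a qd qr ((σlo + εlo) / 2) ET
  set P := zMono E j (z a) (zb a)
  have hP : 0 ≤ P := zMono_nonneg E j (hz a).1.le (hzb a).1.le
  have hva : 0 < (1 - z a) * (1 - zb a) ∧ (1 - z a) * (1 - zb a) ≤ 1 :=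
    ⟨mul_pos (by linarith [(hz a).2]) (by linarith [(hzb a).2]),
      mul_le_one₀ (by linarith [(hz a).1]) (by linarith [(hzb a).2]) (by linarith [(hzb a).1])⟩
  have hqd0 : ∀ k, 0 < qd k := fun k => (hqd k).1
  have hqr0 : ∀ k, 0 < qr k := fun k => (hqr k).1
  have hqd0' : ∀ k, 0 ≤ qd k := fun k => (hqd k).1.le
  have hqr0' : ∀ k, 0 ≤ qr k := fun k => (hqr k).1.le
  have hs : (σlo + εlo) / 2 ≤ (Δσ + Δε) / 2 := by linarith [hσ.1, hε.1]
  -- R monotonicity: R(w; t, E) ≤ R(w; t_lo, E_T) for t ≥ t_lo, E ≥ E_T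
  have hRle : ∀ (w' : Fin N → ℝ) {tlo t : ℝ}, tlo ≤ t →
      apexRest w' z zb a qd qr t E ≤ apexRest w' z zb a qd qr tlo ET := fun w' tlo t ht =>
    (apexRest_anti_exponent w' z zb hz hzb a qd qr hqd0' hqr0' ht E).trans
      (apexRest_anti_level w' z zb hz hzb a qd qr hqd hqr tlo hTE)
  -- X
  have hb0 := apex_bounds_pointFunctional_crossF_zMono (w 0) z zb hz hzb hord a qd qr hqd0 hqr0 hdomd
    hdomr hjE Δσ (-1) (by norm_num)
  have hXle : P * XT ≤ pointFunctional (w 0) z zb (crossF Δσ (-1) (zMono E j)) := by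
    refine le_trans (mul_le_mul_of_nonneg_left ?_ hP) hb0.1
    have hv : w 0 a * ((1 - z a) * (1 - zb a)) ^ σhi ≤ w 0 a * ((1 - z a) * (1 - zb a)) ^ Δσ :=
      mul_le_mul_of_nonneg_left (Real.rpow_le_rpow_of_exponent_ge hva.1 hva.2 hσ.2) h0
    linarith [hRle (w 0) hσ.1]
  -- Y
  have hb1 := apex_bounds_pointFunctional_crossF_zMono (w 1) z zb hz hzb hord a qd qr hqd0 hqr0 hdomd
    hdomr hjE Δε (-1) (by norm_num)
  have hYle : P * YT ≤ pointFunctional (w 1) z zb (crossF Δε (-1) (zMono E j)) := by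
    refine le_trans (mul_le_mul_of_nonneg_left ?_ hP) hb1.1
    have hv : w 1 a * ((1 - z a) * (1 - zb a)) ^ εhi ≤ w 1 a * ((1 - z a) * (1 - zb a)) ^ Δε :=
      mul_le_mul_of_nonneg_left (Real.rpow_le_rpow_of_exponent_ge hva.1 hva.2 hε.2) h1
    linarith [hRle (w 1) hε.1]
  -- Z
  set Z := pointFunctional (w 3) z zb (crossF ((Δσ + Δε) / 2) (-1) (zMono E j)) +
    pointFunctional (w 4) z zb (crossF ((Δσ + Δε) / 2) 1 (zMono E j))
  have h3 := abs_pointFunctional_crossF_zMono_sub_apex_le (w 3) z zb hz hzb hord a qd qr hqd0 hqr0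
    hdomd hdomr hjE ((Δσ + Δε) / 2) (-1) (by norm_num)
  have h4 := abs_pointFunctional_crossF_zMono_sub_apex_le (w 4) z zb hz hzb hord a qd qr hqd0 hqr0
    hdomd hdomr hjE ((Δσ + Δε) / 2) 1 (by norm_num)
  have hvs : ((1 - z a) * (1 - zb a)) ^ ((Δσ + Δε) / 2) ≤ ((1 - z a) * (1 - zb a)) ^ ((σlo + εlo) / 2) :=
    Real.rpow_le_rpow_of_exponent_ge hva.1 hva.2 hs
  have hvs0 : 0 ≤ ((1 - z a) * (1 - zb a)) ^ ((Δσ + Δε) / 2) := Real.rpow_nonneg hva.1.le _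
  have hZabs : |Z| ≤ P * ZT := by
    have hsum : Z = (pointFunctional (w 3) z zb (crossF ((Δσ + Δε) / 2) (-1) (zMono E j)) -
        w 3 a * ((1 - z a) * (1 - zb a)) ^ ((Δσ + Δε) / 2) * P) +
        (pointFunctional (w 4) z zb (crossF ((Δσ + Δε) / 2) 1 (zMono E j)) -
          w 4 a * ((1 - z a) * (1 - zb a)) ^ ((Δσ + Δε) / 2) * P) +
        (w 3 a + w 4 a) * ((1 - z a) * (1 - zb a)) ^ ((Δσ + Δε) / 2) * P := by ring
    have hlast : |(w 3 a + w 4 a) * ((1 - z a) * (1 - zb a)) ^ ((Δσ + Δε) / 2) * P| ≤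
        |w 3 a + w 4 a| * ((1 - z a) * (1 - zb a)) ^ ((σlo + εlo) / 2) * P := by
      rw [abs_mul, abs_mul, abs_of_nonneg hvs0, abs_of_nonneg hP]
      exact mul_le_mul_of_nonneg_right (mul_le_mul_of_nonneg_left hvs (abs_nonneg _)) hP
    have hR3 := hRle (w 3) hs
    have hR4 := hRle (w 4) hs
    calc |Z| ≤ |pointFunctional (w 3) z zb (crossF ((Δσ + Δε) / 2) (-1) (zMono E j)) -
              w 3 a * ((1 - z a) * (1 - zb a)) ^ ((Δσ + Δε) / 2) * P| +
            |pointFunctional (w 4) z zb (crossF ((Δσ + Δε) / 2) 1 (zMono E j)) -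
              w 4 a * ((1 - z a) * (1 - zb a)) ^ ((Δσ + Δε) / 2) * P| +
            |(w 3 a + w 4 a) * ((1 - z a) * (1 - zb a)) ^ ((Δσ + Δε) / 2) * P| := by
          rw [hsum]; exact (abs_add_le _ _).trans (add_le_add (abs_add_le _ _) le_rfl)
      _ ≤ P * apexRest (w 3) z zb a qd qr ((Δσ + Δε) / 2) E +
            P * apexRest (w 4) z zb a qd qr ((Δσ + Δε) / 2) E +
            |w 3 a + w 4 a| * ((1 - z a) * (1 - zb a)) ^ ((σlo + εlo) / 2) * P :=
          add_le_add (add_le_add h3 h4) hlast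
      _ ≤ P * apexRest (w 3) z zb a qd qr ((σlo + εlo) / 2) ET +
            P * apexRest (w 4) z zb a qd qr ((σlo + εlo) / 2) ET +
            |w 3 a + w 4 a| * ((1 - z a) * (1 - zb a)) ^ ((σlo + εlo) / 2) * P :=
          add_le_add (add_le_add (mul_le_mul_of_nonneg_left hR3 hP)
            (mul_le_mul_of_nonneg_left hR4 hP)) le_rfl
      _ = P * ZT := by ring
  have hZT0 : 0 ≤ ZT :=
    add_nonneg (add_nonneg (mul_nonneg (abs_nonneg _) (Real.rpow_nonneg hva.1.le _))
      (apexRest_nonneg _ z zb hz hzb a qd qr hqd0' hqr0' _ _))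
      (apexRest_nonneg _ z zb hz hzb a qd qr hqd0' hqr0' _ _)
  have hPX : 0 ≤ P * XT := mul_nonneg hP hX
  have hPY : 0 ≤ P * YT := mul_nonneg hP hY
  refine evenTermForm_nonneg_of_det z zb w (hPX.trans hXle) (hPY.trans hYle) ?_ x y
  have hZsq : Z ^ 2 ≤ (P * ZT) ^ 2 := by
    rw [← sq_abs Z]
    exact pow_le_pow_left₀ (abs_nonneg Z) hZabs 2
  calc Z ^ 2 ≤ (P * ZT) ^ 2 := hZsq
    _ = P ^ 2 * ZT ^ 2 := by ring
    _ ≤ P ^ 2 * (4 * XT * YT) := mul_le_mul_of_nonneg_left hZ (sq_nonneg P)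
    _ = 4 * (P * XT) * (P * YT) := by ring
    _ ≤ 4 * pointFunctional (w 0) z zb (crossF Δσ (-1) (zMono E j)) *
          pointFunctional (w 1) z zb (crossF Δε (-1) (zMono E j)) :=
        mul_le_mul (mul_le_mul_of_nonneg_left hXle (by norm_num)) hYle hPY
          (mul_nonneg (by norm_num) (hPX.trans hXle))

/-! ### The even-sector tail (E5) from (M) and (T) -/

/-- **(E5) at a regular point, twist-gap domain.** Termwise PSD of the even term form for
`E ∈ [E₀, E_T)`, `j + τ ≤ E` (rule (M), `τ ≤ 1`, `τ ≤ E₀`) and for `E ≥ E_T`, `j ≤ E` (rule (T)) give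
`EvenPositive` at every regular `(Δ, ℓ)` with `Δ ≥ E₀` above the unitarity bound.
[cite: HogervorstRychkov2013, §3 eq. (3.6)] -/
theorem tail_evenPositive_of_termwise_regular {N : ℕ} (z zb : Fin N → ℝ) (w : Fin 5 → Fin N → ℝ)
    (hz : ∀ k, z k ∈ Ioo (0 : ℝ) 1) (hzb : ∀ k, zb k ∈ Ioo (0 : ℝ) 1) {Δσ Δε E₀ ET τ : ℝ}
    (hτ1 : τ ≤ 1) (hτ0 : τ ≤ E₀)
    (hM : ∀ (j : ℕ) (E : ℝ), E₀ ≤ E → E < ET → (j : ℝ) + τ ≤ E →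
      ∀ x y : ℝ, 0 ≤ evenTermForm z zb w Δσ Δε E j x y)
    (hT : ∀ E : ℝ, ET ≤ E → ∀ j : ℕ, (j : ℝ) ≤ E → ∀ x y : ℝ, 0 ≤ evenTermForm z zb w Δσ Δε E j x y)
    {Δ : ℝ} {ℓ : ℕ} (hΔ : unitarityBound3D ℓ < Δ) (hreg : ¬ accidentalDegeneracy3D Δ ℓ)
    (hΔ0 : E₀ ≤ Δ) :
    (CrossingFunctional.ofPoints z zb w).EvenPositive Δσ Δε Δ ℓ := by
  refine evenPositive_ofPoints_of_forall z zb w hz hzb hΔ hreg fun q hq x y => ?_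
  have hℓτ : (ℓ : ℝ) + τ ≤ Δ := natCast_add_le_of_unitarityBound3D_lt hτ1 hτ0 hΔ hΔ0
  have h1 : (q.2 : ℝ) ≤ (ℓ : ℝ) + (q.1 : ℝ) := by exact_mod_cast hq.2.1
  have hjE : (q.2 : ℝ) + τ ≤ Δ + (q.1 : ℝ) := by linarith
  have hjE' : (q.2 : ℝ) ≤ Δ + (q.1 : ℝ) := by
    linarith [natCast_add_half_le_unitarityBound3D ℓ]
  have hE0 : E₀ ≤ Δ + (q.1 : ℝ) := hΔ0.trans (le_add_of_nonneg_right (Nat.cast_nonneg _))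
  by_cases hlt : Δ + (q.1 : ℝ) < ET
  · exact hM q.2 (Δ + (q.1 : ℝ)) hE0 hlt hjE x y
  · exact hT (Δ + (q.1 : ℝ)) (not_lt.1 hlt) q.2 hjE' x y

/-- **(E5) on a box, all points.** As `tail_evenPositive_of_termwise_regular`, uniformly for
`(Δ_σ, Δ_ε) ∈ Q ⊆ [σ_lo,σ_hi] × [ε_lo,ε_hi]`, with rule (T) discharged by the apex numbers of
`evenTermForm_nonneg_of_apex`, and at every `Δ ≥ E₀` with `unitarityBound3D ℓ ≤ Δ` (non-regular
points by right limits). [cite: HogervorstRychkov2013, §3 eq. (3.6)] -/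
theorem tail_evenPositive_of_boxes_and_apex {N : ℕ} (z zb : Fin N → ℝ) (w : Fin 5 → Fin N → ℝ)
    (hz : ∀ k, z k ∈ Ioo (0 : ℝ) 1) (hzb : ∀ k, zb k ∈ Ioo (0 : ℝ) 1) (hord : ∀ k, zb k ≤ z k)
    (a : Fin N) (qd qr : Fin N → ℝ) (hqd : ∀ k, 0 < qd k ∧ qd k ≤ 1)
    (hqr : ∀ k, 0 < qr k ∧ qr k ≤ 1)
    (hdomd : ∀ k, z k * zb k ≤ qd k ^ 2 * (z a * zb a) ∧ z k ≤ qd k * z a)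
    (hdomr : ∀ k, (1 - z k) * (1 - zb k) ≤ qr k ^ 2 * (z a * zb a) ∧ 1 - zb k ≤ qr k * z a)
    {Q : Set (ℝ × ℝ)} {σlo σhi εlo εhi E₀ ET τ : ℝ}
    (hQ : ∀ p ∈ Q, (σlo ≤ p.1 ∧ p.1 ≤ σhi) ∧ (εlo ≤ p.2 ∧ p.2 ≤ εhi))
    (hτ1 : τ ≤ 1) (hτ0 : τ ≤ E₀)
    (hM : ∀ (j : ℕ) (E : ℝ), E₀ ≤ E → E < ET → (j : ℝ) + τ ≤ E → ∀ p ∈ Q,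
      ∀ x y : ℝ, 0 ≤ evenTermForm z zb w p.1 p.2 E j x y)
    (h0 : 0 ≤ w 0 a) (h1 : 0 ≤ w 1 a)
    (hX : 0 ≤ w 0 a * ((1 - z a) * (1 - zb a)) ^ σhi - apexRest (w 0) z zb a qd qr σlo ET)
    (hY : 0 ≤ w 1 a * ((1 - z a) * (1 - zb a)) ^ εhi - apexRest (w 1) z zb a qd qr εlo ET)
    (hZ : (|w 3 a + w 4 a| * ((1 - z a) * (1 - zb a)) ^ ((σlo + εlo) / 2)
            + apexRest (w 3) z zb a qd qr ((σlo + εlo) / 2) ET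
            + apexRest (w 4) z zb a qd qr ((σlo + εlo) / 2) ET) ^ 2 ≤
        4 * (w 0 a * ((1 - z a) * (1 - zb a)) ^ σhi - apexRest (w 0) z zb a qd qr σlo ET) *
          (w 1 a * ((1 - z a) * (1 - zb a)) ^ εhi - apexRest (w 1) z zb a qd qr εlo ET)) :
    ∀ p ∈ Q, ∀ ℓ : ℕ, ∀ Δ : ℝ, unitarityBound3D ℓ ≤ Δ → E₀ ≤ Δ →
      (CrossingFunctional.ofPoints z zb w).EvenPositive p.1 p.2 Δ ℓ := by
  intro p hp ℓ Δ hbd hΔ0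
  have hT := evenTermForm_nonneg_of_apex z zb w hz hzb hord a qd qr hqd hqr hdomd hdomr h0 h1 hX hY hZ
  have hTp : ∀ E : ℝ, ET ≤ E → ∀ j : ℕ, (j : ℝ) ≤ E → ∀ x y : ℝ,
      0 ≤ evenTermForm z zb w p.1 p.2 E j x y :=
    fun E hE j hj x y => hT E hE j hj p.1 ⟨(hQ p hp).1.1, (hQ p hp).1.2⟩ p.2
      ⟨(hQ p hp).2.1, (hQ p hp).2.2⟩ x y
  have hMp : ∀ (j : ℕ) (E : ℝ), E₀ ≤ E → E < ET → (j : ℝ) + τ ≤ E →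
      ∀ x y : ℝ, 0 ≤ evenTermForm z zb w p.1 p.2 E j x y :=
    fun j E hE hlt hj x y => hM j E hE hlt hj p hp x y
  by_cases hregpt : IsRegularPoint3D Δ ℓ
  · exact tail_evenPositive_of_termwise_regular z zb w hz hzb hτ1 hτ0 hMp hTp
      (lt_of_le_of_ne hbd (Ne.symm hregpt.1)) hregpt.2 hΔ0
  · refine evenPositive_ofPoints_of_eventually_right z zb w hz hzb p.1 p.2 Δ ℓ hregpt ?_
    filter_upwards [eventually_isRegularPoint3D_nhdsGT_of_bound_le hbd, self_mem_nhdsWithin]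
      with Δ' hΔ' hgt
    have hgt' : Δ < Δ' := Set.mem_Ioi.1 hgt
    exact ⟨hΔ', tail_evenPositive_of_termwise_regular z zb w hz hzb hτ1 hτ0 hMp hTp
      (lt_of_le_of_lt hbd hgt') hΔ'.2 (hΔ0.trans hgt'.le)⟩

/-! ### (I) the identity, and the schema -/

/-- **The identity term of a point 5-vector in closed form**: `identityTerm = φ_{w¹}[F^{Δσ}_-[1]] +
φ_{w²}[F^{Δε}_-[1]] + (φ_{w⁴}[F^{s}_-[1]] + φ_{w⁵}[F^{s}_+[1]])`. [cite: KosPolandSimmonsduffin2014, §3.2 eq. (3.15)] -/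
theorem identityTerm_ofPoints {N : ℕ} (z zb : Fin N → ℝ) (w : Fin 5 → Fin N → ℝ) (Δσ Δε : ℝ) :
    (CrossingFunctional.ofPoints z zb w).identityTerm Δσ Δε =
      pointFunctional (w 0) z zb (crossF Δσ (-1) (zMono 0 0)) +
        pointFunctional (w 1) z zb (crossF Δε (-1) (zMono 0 0)) +
        twoWeightEval (w 3 + w 4) (w 3 - w 4) z zb ((Δσ + Δε) / 2) (zMono 0 0) := by
  rw [zMono_zero_zero, ← sum45_eq_twoWeightEval]
  simp only [CrossingFunctional.identityTerm, CrossingFunctional.ofPoints]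
  ring

/-- **(I) on a box from three corner numbers.** [folklore] -/
theorem identityTerm_ofPoints_pos_of_cornerBounds {N : ℕ} (z zb : Fin N → ℝ)
    (w : Fin 5 → Fin N → ℝ) (hz : ∀ k, z k ∈ Ioo (0 : ℝ) 1) (hzb : ∀ k, zb k ∈ Ioo (0 : ℝ) 1)
    {Q : Set (ℝ × ℝ)} {σlo σhi εlo εhi : ℝ}
    (hQ : ∀ p ∈ Q, (σlo ≤ p.1 ∧ p.1 ≤ σhi) ∧ (εlo ≤ p.2 ∧ p.2 ≤ εhi))
    (hI : 0 < termCornerBound (w 0) z zb 0 0 0 σlo σhi + termCornerBound (w 1) z zb 0 0 0 εlo εhi +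
      cornerBound₂ (w 3 + w 4) (w 3 - w 4) z zb 0 0 0 ((σlo + εlo) / 2) ((σhi + εhi) / 2)) :
    ∀ p ∈ Q, 0 < (CrossingFunctional.ofPoints z zb w).identityTerm p.1 p.2 := by
  intro p hp
  rw [identityTerm_ofPoints]
  obtain ⟨hσ, hε⟩ := hQ p hp
  have hs : (p.1 + p.2) / 2 ∈ Icc ((σlo + εlo) / 2) ((σhi + εhi) / 2) :=
    ⟨by linarith [hσ.1, hε.1], by linarith [hσ.2, hε.2]⟩
  have h0 := termCornerBound_le (w 0) z zb hz hzb 0 (E := 0) ⟨le_rfl, le_rfl⟩ ⟨hσ.1, hσ.2⟩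
  have h1 := termCornerBound_le (w 1) z zb hz hzb 0 (E := 0) ⟨le_rfl, le_rfl⟩ ⟨hε.1, hε.2⟩
  have h2 := cornerBound₂_le (w 3 + w 4) (w 3 - w 4) z zb hz hzb 0 (E := 0) ⟨le_rfl, le_rfl⟩ hs
  linarith

/-- **The mixed point-certificate schema (even sector closed-form, odd sector as obligations).**
Nodes in the open square with `z̄_k ≤ z_k`, a dominating apex `a` (`qd_k, qr_k ∈ (0,1]`),
`Q ⊆ [σ_lo,σ_hi] × [ε_lo,ε_hi]`. Then: (I) the identity number `> 0`; (E2)–(E4) the even light blocks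
below `E₀` (hypotheses; cell tables); (M) even term forms PSD on `E ∈ [E₀, E_T)`, `j + τ ≤ E`
(`τ ≤ 1`, `τ ≤ E₀`; box by box through `evenTermForm_nonneg_of_cornerBounds`); (T) the three apex
numbers; and the odd-sector obligations (D2)–(D5) (hypotheses) give `BoxExcluded Q`.
[cite: KosPolandSimmonsduffin2014, §3.3 eq. (3.16)] -/
theorem boxExcluded_of_mixedPointRules {N : ℕ} {z zb : Fin N → ℝ} {w : Fin 5 → Fin N → ℝ}
    (hz : ∀ k, z k ∈ Ioo (0 : ℝ) 1) (hzb : ∀ k, zb k ∈ Ioo (0 : ℝ) 1) (hord : ∀ k, zb k ≤ z k)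
    (a : Fin N) (qd qr : Fin N → ℝ) (hqd : ∀ k, 0 < qd k ∧ qd k ≤ 1)
    (hqr : ∀ k, 0 < qr k ∧ qr k ≤ 1)
    (hdomd : ∀ k, z k * zb k ≤ qd k ^ 2 * (z a * zb a) ∧ z k ≤ qd k * z a)
    (hdomr : ∀ k, (1 - z k) * (1 - zb k) ≤ qr k ^ 2 * (z a * zb a) ∧ 1 - zb k ≤ qr k * z a)
    {Q : Set (ℝ × ℝ)} {σlo σhi εlo εhi E₀ ET τ : ℝ}
    (hQ : ∀ p ∈ Q, (σlo ≤ p.1 ∧ p.1 ≤ σhi) ∧ (εlo ≤ p.2 ∧ p.2 ≤ εhi))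
    (hτ1 : τ ≤ 1) (hτ0 : τ ≤ E₀)
    (hI : 0 < termCornerBound (w 0) z zb 0 0 0 σlo σhi + termCornerBound (w 1) z zb 0 0 0 εlo εhi +
      cornerBound₂ (w 3 + w 4) (w 3 - w 4) z zb 0 0 0 ((σlo + εlo) / 2) ((σhi + εhi) / 2))
    (hE2 : ∀ p ∈ Q, (CrossingFunctional.ofPoints z zb w).EvenPositive p.1 p.2 p.2 0)
    (hE3 : ∀ p ∈ Q, ∀ Δ : ℝ, 3 ≤ Δ → Δ < E₀ →
      (CrossingFunctional.ofPoints z zb w).EvenPositive p.1 p.2 Δ 0)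
    (hE4 : ∀ p ∈ Q, ∀ ℓ : ℕ, Even ℓ → ℓ ≠ 0 → ∀ Δ : ℝ, (ℓ : ℝ) + 1 ≤ Δ → Δ < E₀ →
      (CrossingFunctional.ofPoints z zb w).EvenPositive p.1 p.2 Δ ℓ)
    (hM : ∀ (j : ℕ) (E : ℝ), E₀ ≤ E → E < ET → (j : ℝ) + τ ≤ E → ∀ p ∈ Q,
      ∀ x y : ℝ, 0 ≤ evenTermForm z zb w p.1 p.2 E j x y)
    (h0 : 0 ≤ w 0 a) (h1 : 0 ≤ w 1 a)
    (hX : 0 ≤ w 0 a * ((1 - z a) * (1 - zb a)) ^ σhi - apexRest (w 0) z zb a qd qr σlo ET)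
    (hY : 0 ≤ w 1 a * ((1 - z a) * (1 - zb a)) ^ εhi - apexRest (w 1) z zb a qd qr εlo ET)
    (hZ : (|w 3 a + w 4 a| * ((1 - z a) * (1 - zb a)) ^ ((σlo + εlo) / 2)
            + apexRest (w 3) z zb a qd qr ((σlo + εlo) / 2) ET
            + apexRest (w 4) z zb a qd qr ((σlo + εlo) / 2) ET) ^ 2 ≤
        4 * (w 0 a * ((1 - z a) * (1 - zb a)) ^ σhi - apexRest (w 0) z zb a qd qr σlo ET) *
          (w 1 a * ((1 - z a) * (1 - zb a)) ^ εhi - apexRest (w 1) z zb a qd qr εlo ET))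
    (hD2 : ∀ p ∈ Q, (CrossingFunctional.ofPoints z zb w).OddPositive p.1 p.2 p.1 0)
    (hD3 : ∀ p ∈ Q, ∀ Δ : ℝ, 3 ≤ Δ → Δ < E₀ →
      (CrossingFunctional.ofPoints z zb w).OddPositive p.1 p.2 Δ 0)
    (hD4 : ∀ p ∈ Q, ∀ ℓ : ℕ, ℓ ≠ 0 → ∀ Δ : ℝ, (ℓ : ℝ) + 1 ≤ Δ → Δ < E₀ →
      (CrossingFunctional.ofPoints z zb w).OddPositive p.1 p.2 Δ ℓ)
    (hD5 : ∀ p ∈ Q, ∀ ℓ : ℕ, ∀ Δ : ℝ, unitarityBound3D ℓ ≤ Δ → E₀ ≤ Δ →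
      (CrossingFunctional.ofPoints z zb w).OddPositive p.1 p.2 Δ ℓ) :
    BoxExcluded Q :=
  MixedObligations.boxExcluded (E₀ := E₀) hz hzb
    { identity_pos := identityTerm_ofPoints_pos_of_cornerBounds z zb w hz hzb hQ hI
      epsilon_even := hE2
      scalar_even := hE3
      spinning_even := hE4
      tail_even := fun p hp ℓ _ Δ hbd hΔ0 =>
        tail_evenPositive_of_boxes_and_apex z zb w hz hzb hord a qd qr hqd hqr hdomd hdomr hQ hτ1 hτ0
          hM h0 h1 hX hY hZ p hp ℓ Δ hbd hΔ0
      sigma_odd := hD2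
      scalar_odd := hD3
      spinning_odd := hD4
      tail_odd := hD5 }

end Literature.MathematicalPhysics.QuantumFieldTheory.ConformalBootstrap3D
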